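import Literature.AlgebraicGeometry.Motives.CartierDivisor
import Mathlib.AlgebraicGeometry.Morphisms.Smooth
import Mathlib.RingTheory.Smooth.StandardSmoothCotangent
import Mathlib.RingTheory.Etale.Kaehler
import Mathlib.RingTheory.Localization.Module
import Mathlib.LinearAlgebra.Determinant
import HarnessLib

/-!
# Local coordinates on a smooth scheme over a field: exact bases of the Kähler differentials of the
# local rings and of the function field, and the Jacobian cocycle

Topic `Literature/AlgebraicGeometry/Motives` (proofs only; no definitions, no named facts), in the
rational-function currency `RatFn` of `Literature/AlgebraicGeometry/Motives/CartierDivisor.lean`.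
Let `k` be a field and `X` an integral `k`-scheme (Mathlib `X.Over (Spec k)`) smooth of relative
dimension `n`; the local rings `𝒪_{X,x}` and the function field `K(X)` are `k`-algebras
(`RatFn.algebraStalk`). Then:

* `exists_basis_kaehlerDifferential_eq_D` (ring form) — a non-trivial standard smooth algebra of
  relative dimension `n` has a basis of `Ω` consisting of `n` EXACT differentials `d zᵢ`
  (Mathlib `SubmersivePresentation.basisKaehler`, reindexed);
* `Basis.exists_ofIsLocalizedModule_kaehler_eq_D` — such a basis localises to one of `Ω[T⁄R]` for a
  localisation `T` of `S`, again exact;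
* `exists_localCoordinates` — **local coordinates**: for every `x ∈ X` there are
  `z₁, …, zₙ ∈ 𝒪_{X,x}` whose differentials form a basis of `Ω[𝒪_{X,x}⁄k]`
  (Bosch–Lütkebohmert–Raynaud, *Néron Models*, §2.2 Prop. 11 / Def. 12: «a system of coordinates
  at `x`»; Görtz–Wedhorn II, Thm. 18.59);
* `exists_basis_functionField_of_localCoordinates` — their images are a `K(X)`-basis of
  `Ω[K(X)⁄k]` (`Ω` commutes with localisation);
* `isUnitAt_det_of_localCoordinates` — **the Jacobian of two systems of coordinates at `x` is a
  unit at `x`**: for coordinates `z, z'` at `x` with function-field bases `B, B'`, the rational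
  function `B'.det B = det (∂zᵢ/∂z'ⱼ) ∈ K(X)` lies in `𝒪_{X,x}ˣ` (BLR §2.2, proof of Prop. 11;
  this is what makes «a rational top form `f · dz₁ ∧ … ∧ dzₙ` is a frame at `x`» independent of
  the coordinates), together with the cocycle `B''.det B' * B'.det B = B''.det B`
  (`Basis.det` / `Basis.toMatrix_mul_toMatrix`).

Cell `hodgecm-mathlib`, road W of `r₀` (W0-SPEC §2 currency, leaf L4a infrastructure).

## Sources

* S. Bosch, W. Lütkebohmert, M. Raynaud, *Néron Models*, Springer 1990, §2.2 (Prop. 11, Def. 12: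
  systems of coordinates / étale coordinates on smooth schemes). [BLRNeronModels1990]
* U. Görtz, T. Wedhorn, *Algebraic Geometry II* (2023), Thm. 18.59, Cor. 18.62 (local structure of
  smooth morphisms; `Ω¹` locally free with basis `d f₁, …, d f_d`). [GortzWedhorn2023]
-/

noncomputable section

universe u

open CategoryTheory AlgebraicGeometry Opposite

namespace Literature.AlgebraicGeometry.Motives

/-! ### Ring form: exact bases of `Ω` for standard smooth algebras and their localisations -/

section Ring

/-- A non-trivial standard smooth algebra `S` of relative dimension `n` over `R` has a basis of
`Ω[S⁄R]` consisting of `n` exact differentials `d z₁, …, d zₙ` (Mathlib's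
`SubmersivePresentation.basisKaehler`, the differentials of the free generators of a submersive
presentation, reindexed by `Fin n`). [cite: GortzWedhorn2023, Thm. 18.59 / Cor. 18.62] -/
theorem exists_basis_kaehlerDifferential_eq_D (R S : Type u) [CommRing R] [CommRing S]
    [Algebra R S] [Nontrivial S] (n : ℕ) [Algebra.IsStandardSmoothOfRelativeDimension n R S] :
    ∃ (z : Fin n → S) (b : Module.Basis (Fin n) S Ω[S⁄R]),
      ∀ i, b i = KaehlerDifferential.D R S (z i) := by
  obtain ⟨ι, σ, _, _, ⟨P, hP⟩⟩ := ‹Algebra.IsStandardSmoothOfRelativeDimension n R S›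
  classical
  letI : Fintype ι := Fintype.ofFinite ι
  letI : Fintype σ := Fintype.ofFinite σ
  have hcard : Fintype.card ((Set.range P.map)ᶜ : Set ι) = n := by
    rw [Fintype.card_compl_set, Set.card_range_of_injective P.map_inj, ← hP,
      Algebra.Presentation.dimension, Nat.card_eq_fintype_card, Nat.card_eq_fintype_card]
  let e : ((Set.range P.map)ᶜ : Set ι) ≃ Fin n := Fintype.equivFinOfCardEq hcard
  refine ⟨fun i => P.val (e.symm i), P.basisKaehler.reindex e, fun i => ?_⟩
  rw [Module.Basis.reindex_apply, Algebra.SubmersivePresentation.basisKaehler_apply]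

/-- An exact basis `d zᵢ` of `Ω[S⁄R]` localises to the exact basis `d (zᵢ)` of `Ω[T⁄R]` for a
localisation `T = M⁻¹S` (Mathlib: `Ω` commutes with localisation,
`KaehlerDifferential.isLocalizedModule_map`, `Basis.ofIsLocalizedModule`, `KaehlerDifferential.map_D`).
[cite: GortzWedhorn2023, Cor. 18.62 (with localisation of `Ω`, Prop. 17.14)] -/
theorem exists_basis_kaehler_localization_eq_D {R S : Type u} (T : Type u) [CommRing R]
    [CommRing S] [CommRing T] [Algebra R S] [Algebra S T] [Algebra R T] [IsScalarTower R S T]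
    (M : Submonoid S) [IsLocalization M T] {ι : Type*} {z : ι → S}
    (b : Module.Basis ι S Ω[S⁄R]) (hb : ∀ i, b i = KaehlerDifferential.D R S (z i)) :
    ∃ b' : Module.Basis ι T Ω[T⁄R], ∀ i, b' i = KaehlerDifferential.D R T (algebraMap S T (z i)) := by
  refine ⟨b.ofIsLocalizedModule T M (KaehlerDifferential.map R R S T), fun i => ?_⟩
  rw [Module.Basis.ofIsLocalizedModule_apply, hb, KaehlerDifferential.map_D]

end Ring

/-! ### Local coordinates at a point of a smooth scheme over a field -/

section Scheme

open RatFn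

variable {k : Type u} [Field k] {X : Scheme.{u}} [IsIntegral X] [X.Over (Spec (.of k))] (n : ℕ)

omit [IsIntegral X] in
/-- **Local coordinates** (Bosch–Lütkebohmert–Raynaud §2.2 Prop. 11 / Def. 12; Görtz–Wedhorn II
Thm. 18.59): at every point `x` of a `k`-scheme `X` smooth of relative dimension `n` there are
`z₁, …, zₙ ∈ 𝒪_{X,x}` whose differentials `d z₁, …, d zₙ` form a basis of the free rank-`n` module
`Ω[𝒪_{X,x}⁄k]` (a standard smooth affine chart `V ∋ x` has an exact basis of `Ω[Γ(V)⁄k]`,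
which localises to `𝒪_{X,x} = Γ(V)_{𝔭_x}`). [cite: BLRNeronModels1990, §2.2 Prop. 11 and Def. 12] -/
theorem exists_localCoordinates [SmoothOfRelativeDimension n (X ↘ Spec (.of k))] (x : X) :
    ∃ (z : Fin n → X.presheaf.stalk x) (b : Module.Basis (Fin n) (X.presheaf.stalk x)
      Ω[X.presheaf.stalk x⁄k]), ∀ i, b i = KaehlerDifferential.D k _ (z i) := by
  obtain ⟨U, hU, V, hV, hxV, e, hsm⟩ :=
    SmoothOfRelativeDimension.exists_isStandardSmoothOfRelativeDimension (n := n)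
      (f := X ↘ Spec (.of k)) x
  -- `U = ⊤`: the only open of `Spec k` containing a point
  have hUtop : U = ⊤ := by
    haveI : Subsingleton (Spec (CommRingCat.of k)) :=
      inferInstanceAs (Subsingleton (PrimeSpectrum k))
    refine top_le_iff.mp fun p _ => ?_
    have hmem : (X ↘ Spec (.of k)).base x ∈ U := e hxV
    rwa [Subsingleton.elim p ((X ↘ Spec (.of k)).base x)]
  subst hUtop
  -- the chart algebra `k = Γ(Spec k) → Γ(X, ⊤) → Γ(X, V)` is standard smooth of relative dimension `n`
  letI algV : Algebra k Γ(X, V) :=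
    ((Scheme.ΓSpecIso (.of k)).inv ≫ (X ↘ Spec (.of k)).appLE ⊤ V le_top).hom.toAlgebra
  have hchart : (algebraMap k Γ(X, V)).IsStandardSmoothOfRelativeDimension n := by
    rw [RingHom.algebraMap_toAlgebra, CommRingCat.hom_comp]
    exact RingHom.isStandardSmoothOfRelativeDimension_respectsIso.right _
      (Scheme.ΓSpecIso (.of k)).symm.commRingCatIsoToRingEquiv hsm
  haveI : Algebra.IsStandardSmoothOfRelativeDimension n k Γ(X, V) :=
    hchart.toAlgebra
  haveI : Nonempty V := ⟨⟨x, hxV⟩⟩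
  haveI : Nontrivial Γ(X, V) := inferInstance
  obtain ⟨z, b, hb⟩ := exists_basis_kaehlerDifferential_eq_D k Γ(X, V) n
  -- localise at `x`: `k → Γ(X, V) → 𝒪_{X,x}` is the structure map of `RatFn.algebraStalk`
  letI : Algebra Γ(X, V) (X.presheaf.stalk x) := (X.presheaf.germ V x hxV).hom.toAlgebra
  haveI : IsScalarTower k Γ(X, V) (X.presheaf.stalk x) := by
    refine IsScalarTower.of_algebraMap_eq fun c => ?_
    rw [RatFn.algebraMap_stalk_apply, RingHom.algebraMap_toAlgebra, RingHom.algebraMap_toAlgebra,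
      Scheme.Hom.appLE]
    simp only [CommRingCat.hom_comp, RingHom.coe_comp, Function.comp_apply]
    rw [← CommRingCat.comp_apply (X.presheaf.map _) (X.presheaf.germ V x hxV), X.presheaf.germ_res]
    rfl
  haveI : IsLocalization.AtPrime (X.presheaf.stalk x) (hV.primeIdealOf ⟨x, hxV⟩).asIdeal :=
    hV.isLocalization_stalk ⟨x, hxV⟩
  obtain ⟨b', hb'⟩ := exists_basis_kaehler_localization_eq_D (X.presheaf.stalk x)
    (hV.primeIdealOf ⟨x, hxV⟩).asIdeal.primeCompl b hb
  exact ⟨fun i => algebraMap Γ(X, V) _ (z i), b', hb'⟩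

/-- **Coordinates at `x` give a basis of `Ω[K(X)⁄k]`**: the images in `K(X)` of local coordinates
`z₁, …, zₙ ∈ 𝒪_{X,x}` have differentials forming a `K(X)`-basis of `Ω[K(X)⁄k]`
(`K(X) = Frac 𝒪_{X,x}` and `Ω` commutes with localisation). [cite: BLRNeronModels1990, §2.2 Prop. 11] -/
theorem exists_basis_functionField_of_localCoordinates {x : X} {z : Fin n → X.presheaf.stalk x}
    (b : Module.Basis (Fin n) (X.presheaf.stalk x) Ω[X.presheaf.stalk x⁄k])
    (hb : ∀ i, b i = KaehlerDifferential.D k _ (z i)) :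
    ∃ B : Module.Basis (Fin n) X.functionField Ω[X.functionField⁄k],
      ∀ i, B i = KaehlerDifferential.D k _ (toFunctionField x (z i)) :=
  exists_basis_kaehler_localization_eq_D X.functionField (nonZeroDivisors (X.presheaf.stalk x)) b hb

/-- The function-field basis attached to local coordinates is unique (a basis is determined by
its values): if `B, B₁` are bases of `Ω[K(X)⁄k]` both equal to `d zᵢ` then `B = B₁` (private
helper). [folklore] -/
private theorem basis_eq_of_localCoordinates {x : X} {z : Fin n → X.presheaf.stalk x}
    {B B₁ : Module.Basis (Fin n) X.functionField Ω[X.functionField⁄k]}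
    (hB : ∀ i, B i = KaehlerDifferential.D k _ (toFunctionField x (z i)))
    (hB₁ : ∀ i, B₁ i = KaehlerDifferential.D k _ (toFunctionField x (z i))) : B = B₁ :=
  Module.Basis.eq_of_apply_eq fun i => (hB i).trans (hB₁ i).symm

/-- **The Jacobian of two systems of local coordinates at `x` is a unit at `x`** (BLR §2.2, proof
of Prop. 11: both `(d zᵢ)` and `(d z'ⱼ)` are bases of the free `𝒪_{X,x}`-module `Ω[𝒪_{X,x}⁄k]`, so
the transition matrix `(∂zᵢ/∂z'ⱼ)` is invertible over `𝒪_{X,x}`): with `B, B'` the `K(X)`-bases of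
`Ω[K(X)⁄k]` given by the coordinates `z, z'` at `x`, the rational function `B'.det B ∈ K(X)` is a
unit at `x` — it is the image of `b'.det b ∈ 𝒪_{X,x}ˣ`. [cite: BLRNeronModels1990, §2.2 Prop. 11] -/
theorem isUnitAt_det_of_localCoordinates {x : X} {z z' : Fin n → X.presheaf.stalk x}
    (b : Module.Basis (Fin n) (X.presheaf.stalk x) Ω[X.presheaf.stalk x⁄k])
    (hb : ∀ i, b i = KaehlerDifferential.D k _ (z i))
    (b' : Module.Basis (Fin n) (X.presheaf.stalk x) Ω[X.presheaf.stalk x⁄k])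
    (hb' : ∀ i, b' i = KaehlerDifferential.D k _ (z' i))
    {B B' : Module.Basis (Fin n) X.functionField Ω[X.functionField⁄k]}
    (hB : ∀ i, B i = KaehlerDifferential.D k _ (toFunctionField x (z i)))
    (hB' : ∀ i, B' i = KaehlerDifferential.D k _ (toFunctionField x (z' i))) :
    B'.det B = toFunctionField x (b'.det b) ∧ IsUnitAt x (B'.det B) := by
  -- identify `B, B'` with the localised bases
  let L := KaehlerDifferential.map k k (X.presheaf.stalk x) X.functionField
  have hBL : B = b.ofIsLocalizedModule X.functionField (nonZeroDivisors _) L :=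
    basis_eq_of_localCoordinates n hB fun i => by
      rw [Module.Basis.ofIsLocalizedModule_apply, hb, KaehlerDifferential.map_D]
  have hB'L : B' = b'.ofIsLocalizedModule X.functionField (nonZeroDivisors _) L :=
    basis_eq_of_localCoordinates n hB' fun i => by
      rw [Module.Basis.ofIsLocalizedModule_apply, hb', KaehlerDifferential.map_D]
  have hdet : B'.det B = toFunctionField x (b'.det b) := by
    rw [Module.Basis.det_apply, Module.Basis.det_apply, RingHom.map_det]
    congr 1
    ext i j
    rw [RingHom.mapMatrix_apply, Matrix.map_apply, Module.Basis.toMatrix_apply,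
      Module.Basis.toMatrix_apply, hBL, hB'L, Module.Basis.ofIsLocalizedModule_apply,
      Module.Basis.ofIsLocalizedModule_repr_apply]
  refine ⟨hdet, ?_⟩
  obtain ⟨u, hu⟩ := b'.isUnit_det b
  exact ⟨u, by rw [hdet, hu]⟩

/-- **Jacobian cocycle** (chain rule for Jacobian determinants, Bosch–Lütkebohmert–Raynaud §2.1–2.2,
used in the proof of Prop. 2.2/11): for three bases of `Ω[K(X)⁄k]` (e.g. from three systems of
coordinates), `B''.det B' * B'.det B = B''.det B` (`Basis.toMatrix_mul_toMatrix`).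
[cite: BLRNeronModels1990, §2.2 Prop. 11 (proof)] -/
theorem det_mul_det_basis {ι : Type*} [Fintype ι] [DecidableEq ι]
    (B B' B'' : Module.Basis ι X.functionField Ω[X.functionField⁄k]) :
    B''.det B' * B'.det B = B''.det B := by
  rw [Module.Basis.det_apply, Module.Basis.det_apply, Module.Basis.det_apply, ← Matrix.det_mul,
    Module.Basis.toMatrix_mul_toMatrix]

end Scheme

end Literature.AlgebraicGeometry.Motives

end
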